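import Summits.KontsevichZagierPeriods.KontsevichZagierPeriods.Theorems.RootDecompRationalCubeDichotomyRankDescentP09

/-! # `RootDecompRationalCubeDichotomyRankDescentP10` — part 10/14 of the mechanical ≤400-line split of `RankDescent_v12_landing.lean` (sha256 00885b8b9882f02e…)
Source: decomp-kz lens-2 g13 `RankDescent_v12.lean` (HOME/decomp-kz-lens-2/g13/, sha256 00885b8b…; critic g5-18…g5-66 CLEARED as NODE v1–v12 for crux stmt-KontsevichZagierPeriods-26322 RationalCubePiKernelSingle: rank dichotomy single_of_fullRankGeTwo + RankLeOneKernel, de Rham-exact descent, linear-in-one-variable / hyperbola / Fermat–hyperbolic / conic classes, transport kit, Brieskorn module; writer g7 l.1222: «landing split §0–4 ∣ … ∣ §16 --supports 26322 endorsed»); `#print axioms` pins removed; landed by census-1 g9.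
Split by census-1 g9 `gen/splitlean.py`: scopes re-opened with their `open`/`variable`/`set_option` context; mathematics and declaration order unchanged. -/

noncomputable section
open MeasureTheory Set MvPolynomial
open Literature.NumberTheory.Transcendental
open Literature.NumberTheory.Transcendental.KZ
namespace Summit.KontsevichZagierPeriods.RootDecompRationalCubeDichotomy.Rung26322.RankDescent
variable {M : ℕ}

/-- Residual of the line-pair class: crossing-point value NON-ZERO (one rational parameter per pair). [folklore] -/
def LinePairResidual (k a b e c d e' : ℚ) : Prop :=
  ∀ (q : IntegralRep 2) (P : MvPolynomial (Fin 2) ℚ),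
    MvPolynomial.eval ![(0:ℚ), 0] (aeval (affInv a b e c d e') (C k⁻¹ * P)) ≠ 0 →
    q.domain = Set.pi Set.univ (fun _ : Fin 2 => Set.Icc (0:ℝ) 1) →
    (∀ z ∈ Set.pi Set.univ (fun _ : Fin 2 => Set.Icc (0:ℝ) 1),
      MvPolynomial.aeval z (C k * (affMap a b e c d e' 0 * affMap a b e c d e' 1)) ≠ 0) →
    (∀ z ∈ Set.pi Set.univ (fun _ : Fin 2 => Set.Icc (0:ℝ) 1),
      q.integrand z = MvPolynomial.aeval z P
        / MvPolynomial.aeval z (C k * (affMap a b e c d e' 0 * affMap a b e c d e' 1))) →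
    q.value = 0 → ∃ N : ℕ, (fun y : FormalRep => of piRep * y)^[N] (of q) ∈ relations

/-- **26322 on a split conic ⟸ its one-parameter residual (PROVED split).** [folklore] -/
theorem splitConic_single_of_residual (k : ℚ) (hk : k ≠ 0) (a₀ a b e c d e' : ℚ) (hΔ : a * d - b * c ≠ 0)
    (h : SplitConicResidual k a₀ a b e c d e') (q : IntegralRep 2) (P : MvPolynomial (Fin 2) ℚ)
    (hd : q.domain = Set.pi Set.univ (fun _ : Fin 2 => Set.Icc (0:ℝ) 1))
    (hQ : ∀ z ∈ Set.pi Set.univ (fun _ : Fin 2 => Set.Icc (0:ℝ) 1),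
      MvPolynomial.aeval z (C k * (C a₀ + affMap a b e c d e' 0 * affMap a b e c d e' 1)) ≠ 0)
    (hf : ∀ z ∈ Set.pi Set.univ (fun _ : Fin 2 => Set.Icc (0:ℝ) 1),
      q.integrand z = MvPolynomial.aeval z P
        / MvPolynomial.aeval z (C k * (C a₀ + affMap a b e c d e' 0 * affMap a b e c d e' 1)))
    (h0 : q.value = 0) : ∃ N : ℕ, (fun y : FormalRep => of piRep * y)^[N] (of q) ∈ relations := by
  by_cases hP : diagAlt a₀ (aeval (affInv a b e c d e') (C k⁻¹ * P)) = 0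
  · exact ⟨0, by simpa using splitConic_two_mem_relations k hk a₀ a b e c d e' hΔ q P hP hd hQ hf h0⟩
  · exact h q P hP hd hQ hf h0

/-- **26322 on a line pair ⟸ its one-parameter residual (PROVED split).** [folklore] -/
theorem linePair_single_of_residual (k : ℚ) (hk : k ≠ 0) (a b e c d e' : ℚ) (hΔ : a * d - b * c ≠ 0)
    (h : LinePairResidual k a b e c d e') (q : IntegralRep 2) (P : MvPolynomial (Fin 2) ℚ)
    (hd : q.domain = Set.pi Set.univ (fun _ : Fin 2 => Set.Icc (0:ℝ) 1))
    (hQ : ∀ z ∈ Set.pi Set.univ (fun _ : Fin 2 => Set.Icc (0:ℝ) 1),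
      MvPolynomial.aeval z (C k * (affMap a b e c d e' 0 * affMap a b e c d e' 1)) ≠ 0)
    (hf : ∀ z ∈ Set.pi Set.univ (fun _ : Fin 2 => Set.Icc (0:ℝ) 1),
      q.integrand z = MvPolynomial.aeval z P
        / MvPolynomial.aeval z (C k * (affMap a b e c d e' 0 * affMap a b e c d e' 1)))
    (h0 : q.value = 0) : ∃ N : ℕ, (fun y : FormalRep => of piRep * y)^[N] (of q) ∈ relations := by
  by_cases hP : MvPolynomial.eval ![(0:ℚ), 0] (aeval (affInv a b e c d e') (C k⁻¹ * P)) = 0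
  · exact ⟨0, by simpa using linePair_two_mem_relations k hk a b e c d e' hΔ q P hP hd hQ hf h0⟩
  · exact h q P hP hd hQ hf h0

/-! ### §12b Census instances
`1 + x² − y² = 1 + (x − y)(x + y)` (split conic, `a₀ = 1`, `L₁ = x − y`, `L₂ = x + y`, `Δ = 2`): `σ⁻¹ = ((u+v)/2, (v−u)/2)`; e.g. the numerators
`x ↦ (u+v)/2` and `x² + y² ↦ (u² + v²)/2` have functional 0, so `x/(1 + x² − y²)` and `(x² + y²)/(1 + x² − y²)` are exact (decided); `1 ↦ 1`.
`1 + x + x² + 2xy + y² = (x + y)² + x + 1` (parabola type; `L₁ = x + 1`, `L₂ = x + y`, `A₀ = t²`): EVERY numerator decided. -/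

example : affMap 1 0 1 1 1 0 0 + evalAt (X 0 ^ 2) (affMap 1 0 1 1 1 0 1)
    = (1 + X 0 + X 0 ^ 2 + 2 * X 0 * X 1 + X 1 ^ 2 : MvPolynomial (Fin 2) ℚ) := by
  simp [affMap, evalAt]
  ring

/-- On `1 + x² − y² = 1 + (x − y)(x + y)`: the numerator `x` has functional 0 (`σ⁻¹x = (u + v)/2` is linear) — `x/(1 + x² − y²)` is exact
(decided, N = 0); the generator is `1 ↦ 1`. [folklore] -/
example : diagAlt 1 (aeval (affInv 1 (-1) 0 1 1 0) (C (1:ℚ)⁻¹ * (X 0 : MvPolynomial (Fin 2) ℚ))) = 0 := by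
  simp only [affInv, Matrix.cons_val_zero, aeval_X, inv_one, C_1, one_mul, diagAlt_sub, diagAlt_C_mul, diagAlt_X, diagAlt_C]
  ring

example : diagAlt 1 (aeval (affInv 1 (-1) 0 1 1 0) (C (1:ℚ)⁻¹ * (1 : MvPolynomial (Fin 2) ℚ))) = 1 := by
  rw [inv_one, C_1, one_mul, map_one, ← C_1, diagAlt_C]

/-! ## §13 (v9) NORM-FORM CONICS `a₀ + L₁² − D·L₂²` — EVERY rank-2 conic, incl. those IRREDUCIBLE over `ℚ`

For `Q̃ = a₀ + u² − D v²` (`D ∈ ℚˣ`; NOT assumed square, sign free) the infinitesimal automorphism `L = D v ∂_u + u ∂_v` of the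
norm form gives `L h ∈ Ex0 Q̃` for every `h` (`lie_mem`, potentials `(D v h, u h)`), whence the HOP relations
`(i+1)D·u^i v^{j+2} + (j+1)·u^{i+2} v^j ∈ Ex0` (`hop_mem`) and, with `Q̃·u^i ∈ Ex0`, the two-term recursion
`(i+2)·u^{i+2} ≡ −(i+1)a₀·u^i`. So EVERY monomial is congruent mod `Ex0 Q̃` to an explicit rational multiple `lam a₀ D i j` of `1`
(`upow`: `u^{2k} ↦ (−a₀)^k (2k−1)!!/(2k)!!`, odd powers `↦ 0`; `lam i (j+2) = −(j+1)/((i+1)D) · lam (i+2) j`, `lam i 1 = 0`): the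
`ℚ`-RATIONAL functional `normAlt a₀ D` (over `ℚ(√D)` it is §8's `diagAlt` in light-cone coordinates; here it never leaves `ℚ`).
`sub_C_normAlt_mem : P − normAlt(P)·1 ∈ Ex0 Q̃`, so `normAlt P = 0 ⟹ P/Q̃ exact` (`drExact_normConic`), and by §12's affine transport
`Q = k·(a₀ + L₁² − D L₂²)` for independent affine forms (`drExact_conic`, `conic_two_mem_relations` DECIDED N = 0, `ConicResidual` + split).
Completing the square puts EVERY conic with rank-2 quadratic part in this form over `ℚ` (`αx² + βxy + γy² + …`, `α ≠ 0`,
`β² − 4αγ ≠ 0`: `L₁ = x + (β/2α)y + e`, `L₂ = y + e'`, `D = (β² − 4αγ)/4α²`; `α = γ = 0` is §12's split case) — so together with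
§6/§10/§11 (quadratic part of rank 0 or `x`/`y`-degree ≤ 1) and §12 (rank 1) the node now classifies EVERY `Q ∈ ℚ[x,y]` OF TOTAL DEGREE ≤ 2:
26322 there is «decided (N = 0) on a codimension-≤-1 subspace of numerators + at most ONE rational parameter per `Q`» — the whole census box.
§13b: Serret's `1 − 2x + 2x² + 2xy + y² = (x+y)² + (x−1)²` (`a₀ = 0`, `D = −1`: a conjugate line pair through `(1,−1)`, functional = `P(1,−1)`):
`x + y ↦ 0` (exact), `1 ↦ 1` (the `π·log 2` generator); `1 + x² + y²`: `x² − y² ↦ 0` (exact), `x² + y² ↦ −1`. -/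

/-- `a₀ + u² − D·v²`. [folklore] -/
def normQ (a₀ D : ℚ) : MvPolynomial (Fin 2) ℚ := C a₀ + X 0 ^ 2 - C D * X 1 ^ 2

/-- The infinitesimal automorphism `L = D v∂_u + u∂_v` of the norm form: `L h ∈ Ex0 (a₀ + u² − Dv²)` (potentials `(D v h, u h)`). [folklore] -/
theorem lie_mem (a₀ D : ℚ) (h : MvPolynomial (Fin 2) ℚ) :
    C D * X 1 * pderiv 0 h + X 0 * pderiv 1 h ∈ Ex0 (normQ a₀ D) := by
  refine mem_ex0_iff.mpr ⟨![C D * X 1 * h, X 0 * h], ?_⟩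
  simp only [Fin.sum_univ_two, Matrix.cons_val_zero, Matrix.cons_val_one, exS, normQ, map_add, map_sub,
    pderiv_C, Derivation.leibniz, Derivation.leibniz_pow, smul_eq_mul, pderiv_X_self,
    pderiv_one_X_zero, pderiv_zero_X_one, nsmul_eq_mul, Nat.cast_zero, zero_add, map_one, one_mul, mul_one,
    mul_zero, add_zero, sub_zero, Nat.cast_ofNat, Nat.add_one_sub_one, pow_one]
  ring

/-- HOP: `(i+1)D·u^i v^{j+2} + (j+1)·u^{i+2} v^j ∈ Ex0` (`= L(u^{i+1} v^{j+1})`). [folklore] -/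
theorem hop_mem (a₀ D : ℚ) (i j : ℕ) :
    (C ((i + 1 : ℚ) * D) * (X 0 ^ i * X 1 ^ (j + 2)) + C (j + 1 : ℚ) * (X 0 ^ (i + 2) * X 1 ^ j)
      : MvPolynomial (Fin 2) ℚ) ∈ Ex0 (normQ a₀ D) := by
  have key : (C ((i + 1 : ℚ) * D) * (X 0 ^ i * X 1 ^ (j + 2)) + C (j + 1 : ℚ) * (X 0 ^ (i + 2) * X 1 ^ j)
      : MvPolynomial (Fin 2) ℚ)
      = C D * X 1 * pderiv 0 (X 0 ^ (i + 1) * X 1 ^ (j + 1)) + X 0 * pderiv 1 (X 0 ^ (i + 1) * X 1 ^ (j + 1)) := by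
    simp only [Derivation.leibniz, Derivation.leibniz_pow, smul_eq_mul, pderiv_X_self, pderiv_one_X_zero,
      pderiv_zero_X_one, nsmul_eq_mul, mul_one, mul_zero, add_zero, zero_add, Nat.cast_add, Nat.cast_one,
      Nat.add_one_sub_one, map_mul, map_add, map_one, map_natCast]
    ring
  rw [key]
  exact lie_mem a₀ D _

/-- `(i+1)D·u^i v ∈ Ex0` (`= L(u^{i+1})`). [folklore] -/
theorem hop0_mem (a₀ D : ℚ) (i : ℕ) :
    (C ((i + 1 : ℚ) * D) * (X 0 ^ i * X 1) : MvPolynomial (Fin 2) ℚ) ∈ Ex0 (normQ a₀ D) := by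
  have key : (C ((i + 1 : ℚ) * D) * (X 0 ^ i * X 1) : MvPolynomial (Fin 2) ℚ)
      = C D * X 1 * pderiv 0 (X 0 ^ (i + 1)) + X 0 * pderiv 1 (X 0 ^ (i + 1)) := by
    simp only [Derivation.leibniz_pow, smul_eq_mul, pderiv_X_self, pderiv_one_X_zero,
      nsmul_eq_mul, mul_one, mul_zero, add_zero, Nat.cast_add, Nat.cast_one, Nat.add_one_sub_one, map_mul,
      map_add, map_one, map_natCast]
    ring
  rw [key]
  exact lie_mem a₀ D _

/-- `(j+1)·u v^j ∈ Ex0` (`= L(v^{j+1})`). [folklore] -/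
theorem hop1_mem (a₀ D : ℚ) (j : ℕ) :
    (C (j + 1 : ℚ) * (X 0 * X 1 ^ j) : MvPolynomial (Fin 2) ℚ) ∈ Ex0 (normQ a₀ D) := by
  have key : (C (j + 1 : ℚ) * (X 0 * X 1 ^ j) : MvPolynomial (Fin 2) ℚ)
      = C D * X 1 * pderiv 0 (X 1 ^ (j + 1)) + X 0 * pderiv 1 (X 1 ^ (j + 1)) := by
    simp only [Derivation.leibniz_pow, smul_eq_mul, pderiv_X_self, pderiv_zero_X_one,
      nsmul_eq_mul, mul_one, mul_zero, Nat.cast_add, Nat.cast_one, Nat.add_one_sub_one,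
      map_add, map_one, map_natCast]
    ring
  rw [key]
  exact lie_mem a₀ D _

/-- Functional value of `u^n`: `u^{2k} ↦ (−a₀)^k (2k−1)!!/(2k)!!`, odd powers `↦ 0`. [folklore] -/
def upow (a₀ : ℚ) : ℕ → ℚ
  | 0 => 1
  | 1 => 0
  | (i + 2) => -a₀ * ((i + 1 : ℚ) / (i + 2)) * upow a₀ i

/-- Functional value of `u^i v^j` (the light-cone diagonal functional, computed over `ℚ`). [folklore] -/
def lam (a₀ D : ℚ) : ℕ → ℕ → ℚ
  | i, 0 => upow a₀ i
  | _, 1 => 0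
  | i, (j + 2) => -((j + 1 : ℚ) / ((i + 1) * D)) * lam a₀ D (i + 2) j

/-- Auxiliary step `upow_zero` (§13): upow zero. [bookkeeping] -/
theorem upow_zero (a₀ : ℚ) : upow a₀ 0 = 1 := rfl
/-- Auxiliary step `upow_one` (§13): upow one. [bookkeeping] -/
theorem upow_one (a₀ : ℚ) : upow a₀ 1 = 0 := rfl
/-- Auxiliary step `upow_succ_succ` (§13): upow succ succ. [bookkeeping] -/
theorem upow_succ_succ (a₀ : ℚ) (i : ℕ) : upow a₀ (i + 2) = -a₀ * ((i + 1 : ℚ) / (i + 2)) * upow a₀ i := rfl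
/-- Auxiliary step `lam_zero` (§13): lam zero. [bookkeeping] -/
theorem lam_zero (a₀ D : ℚ) (i : ℕ) : lam a₀ D i 0 = upow a₀ i := by rw [lam]
/-- Auxiliary step `lam_one` (§13): lam one. [bookkeeping] -/
theorem lam_one (a₀ D : ℚ) (i : ℕ) : lam a₀ D i 1 = 0 := by rw [lam]
/-- Auxiliary step `lam_succ_succ` (§13): lam succ succ. [bookkeeping] -/
theorem lam_succ_succ (a₀ D : ℚ) (i j : ℕ) :
    lam a₀ D i (j + 2) = -((j + 1 : ℚ) / ((i + 1) * D)) * lam a₀ D (i + 2) j := by rw [lam]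

/-- Pure powers: `u^n − upow(n)·1 ∈ Ex0` (two-term recursion `(n+2)u^{n+2} ≡ −(n+1)a₀ u^n` from `Q̃·u^n` and HOP). [folklore] -/
theorem X0_pow_sub_C_mem (a₀ D : ℚ) (n : ℕ) :
    (X 0 ^ n - C (upow a₀ n) : MvPolynomial (Fin 2) ℚ) ∈ Ex0 (normQ a₀ D) := by
  induction n using Nat.twoStepInduction with
  | zero => rw [upow_zero, pow_zero, C_1, sub_self]; exact zero_mem _
  | one =>
    rw [upow_one, C_0, sub_zero, pow_one]
    have h := hop1_mem a₀ D 0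
    rw [pow_zero, mul_one, Nat.cast_zero, zero_add, C_1, one_mul] at h
    exact h
  | more n ih _ =>
    have hn : (n + 2 : ℚ) ≠ 0 := by positivity
    refine (Submodule.smul_mem_iff _ hn).mp ?_
    have h1 := mul_mem_ex0 (normQ a₀ D) (X 0 ^ n)
    have h2 := hop_mem a₀ D n 0
    simp only [Nat.cast_zero, zero_add, pow_zero, mul_one, map_one, one_mul] at h2
    have hinv : (n + 2 : ℚ) * (n + 2 : ℚ)⁻¹ = 1 := mul_inv_cancel₀ hn
    have hu : (n + 2 : ℚ) * upow a₀ (n + 2) = -((n + 1 : ℚ) * a₀) * upow a₀ n := by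
      rw [upow_succ_succ, div_eq_mul_inv]
      linear_combination (-(n + 1 : ℚ) * a₀ * upow a₀ n) * hinv
    have hu' : (C (n + 2 : ℚ) * C (upow a₀ (n + 2)) : MvPolynomial (Fin 2) ℚ)
        = -(C ((n + 1 : ℚ) * a₀) * C (upow a₀ n)) := by
      rw [← map_mul, hu, neg_mul, map_neg, map_mul]
    have key : ((n + 2 : ℚ) • (X 0 ^ (n + 2) - C (upow a₀ (n + 2))) : MvPolynomial (Fin 2) ℚ)
        = ((n + 1 : ℚ) • (normQ a₀ D * X 0 ^ n)
            + (C ((n + 1 : ℚ) * D) * (X 0 ^ n * X 1 ^ 2) + X 0 ^ (n + 2)))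
          - ((n + 1 : ℚ) * a₀) • (X 0 ^ n - C (upow a₀ n)) := by
      rw [smul_eq_C_mul, smul_eq_C_mul, smul_eq_C_mul, mul_sub, hu', normQ]
      simp only [map_mul, map_add, map_one, map_natCast, map_ofNat]
      ring
    rw [key]
    exact sub_mem (add_mem (Submodule.smul_mem _ _ h1) h2) (Submodule.smul_mem _ _ ih)

/-- **Every monomial is congruent to `lam i j · 1` modulo `Ex0 (a₀ + u² − Dv²)`** (`D ≠ 0`; induction on `j` by HOP). [folklore] -/
theorem normMonomial_sub_C_mem (a₀ D : ℚ) (hD : D ≠ 0) (j : ℕ) :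
    ∀ i : ℕ, (X 0 ^ i * X 1 ^ j - C (lam a₀ D i j) : MvPolynomial (Fin 2) ℚ) ∈ Ex0 (normQ a₀ D) := by
  induction j using Nat.twoStepInduction with
  | zero =>
    intro i
    rw [lam_zero, pow_zero, mul_one]
    exact X0_pow_sub_C_mem a₀ D i
  | one =>
    intro i
    rw [lam_one, C_0, sub_zero, pow_one]
    have hc : ((i + 1 : ℚ) * D) ≠ 0 := mul_ne_zero (by positivity) hD
    refine (Submodule.smul_mem_iff _ hc).mp ?_
    rw [smul_eq_C_mul]
    exact hop0_mem a₀ D i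
  | more j ih _ =>
    intro i
    have hc : ((i + 1 : ℚ) * D) ≠ 0 := mul_ne_zero (by positivity) hD
    refine (Submodule.smul_mem_iff _ hc).mp ?_
    have hinv : ((i + 1 : ℚ) * D) * ((i + 1 : ℚ) * D)⁻¹ = 1 := mul_inv_cancel₀ hc
    have hl : ((i + 1 : ℚ) * D) * lam a₀ D i (j + 2) = -(j + 1 : ℚ) * lam a₀ D (i + 2) j := by
      rw [lam_succ_succ, div_eq_mul_inv]
      linear_combination (-(j + 1 : ℚ) * lam a₀ D (i + 2) j) * hinv
    have hl' : (C ((i + 1 : ℚ) * D) * C (lam a₀ D i (j + 2)) : MvPolynomial (Fin 2) ℚ)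
        = -(C (j + 1 : ℚ) * C (lam a₀ D (i + 2) j)) := by
      rw [← map_mul, hl, neg_mul, map_neg, map_mul]
    have key : (((i + 1 : ℚ) * D) • (X 0 ^ i * X 1 ^ (j + 2) - C (lam a₀ D i (j + 2))) : MvPolynomial (Fin 2) ℚ)
        = (C ((i + 1 : ℚ) * D) * (X 0 ^ i * X 1 ^ (j + 2)) + C (j + 1 : ℚ) * (X 0 ^ (i + 2) * X 1 ^ j))
          - (j + 1 : ℚ) • (X 0 ^ (i + 2) * X 1 ^ j - C (lam a₀ D (i + 2) j)) := by
      rw [smul_eq_C_mul, smul_eq_C_mul, mul_sub, hl']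
      ring
    rw [key]
    exact sub_mem (hop_mem a₀ D i j) (Submodule.smul_mem _ _ (ih (i + 2)))

/-- The summand of the norm-form functional. [folklore] -/
def normFn (a₀ D : ℚ) (d : Fin 2 →₀ ℕ) (a : ℚ) : ℚ := a * lam a₀ D (d 0) (d 1)

/-- **The norm-form functional** `normAlt a₀ D (Σ p_ij u^i v^j) = Σ p_ij · lam a₀ D i j` — the `ℚ`-rational residue functional of
`a₀ + u² − D v²` (equal to §8's light-cone `diagAlt` after base change to `ℚ(√D)`, but computed inside `ℚ`). [folklore] -/
def normAlt (a₀ D : ℚ) (P : MvPolynomial (Fin 2) ℚ) : ℚ := (AddMonoidAlgebra.coeff P).sum (normFn a₀ D)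

/-- Auxiliary step `normAlt_monomial` (§13): norm Alt monomial. [bookkeeping] -/
theorem normAlt_monomial (a₀ D : ℚ) (d : Fin 2 →₀ ℕ) (a : ℚ) :
    normAlt a₀ D (monomial d a) = normFn a₀ D d a :=
  sum_monomial_eq (by simp [normFn])

/-- Auxiliary step `normAlt_add` (§13): norm Alt add. [bookkeeping] -/
theorem normAlt_add (a₀ D : ℚ) (P P' : MvPolynomial (Fin 2) ℚ) :
    normAlt a₀ D (P + P') = normAlt a₀ D P + normAlt a₀ D P' := by
  unfold normAlt
  rw [AddMonoidAlgebra.coeff_add]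
  exact Finsupp.sum_add_index' (fun d => by simp [normFn]) (fun d b₁ b₂ => by unfold normFn; ring)

/-- Auxiliary step `normAlt_C` (§13): norm Alt C. [bookkeeping] -/
theorem normAlt_C (a₀ D a : ℚ) : normAlt a₀ D (C a) = a := by
  rw [← monomial_zero', normAlt_monomial]
  simp [normFn, lam_zero, upow_zero]

/-- Auxiliary step `normAlt_smul` (§13): norm Alt smul. [bookkeeping] -/
theorem normAlt_smul (a₀ D c : ℚ) (P : MvPolynomial (Fin 2) ℚ) : normAlt a₀ D (c • P) = c * normAlt a₀ D P := by
  unfold normAlt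
  rw [AddMonoidAlgebra.coeff_smul, Finsupp.sum_smul_index' (fun d => by simp [normFn]), Finsupp.mul_sum]
  apply Finsupp.sum_congr
  intro d _
  unfold normFn
  simp [smul_eq_mul, mul_assoc]

/-- Auxiliary step `normAlt_C_mul` (§13): norm Alt C mul. [bookkeeping] -/
theorem normAlt_C_mul (a₀ D a : ℚ) (P : MvPolynomial (Fin 2) ℚ) : normAlt a₀ D (C a * P) = a * normAlt a₀ D P := by
  rw [← smul_eq_C_mul, normAlt_smul]

/-- Auxiliary step `normAlt_neg` (§13): norm Alt neg. [bookkeeping] -/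
theorem normAlt_neg (a₀ D : ℚ) (P : MvPolynomial (Fin 2) ℚ) : normAlt a₀ D (-P) = -normAlt a₀ D P := by
  rw [← neg_one_smul ℚ P, normAlt_smul, neg_one_mul]

/-- Auxiliary step `normAlt_sub` (§13): norm Alt sub. [bookkeeping] -/
theorem normAlt_sub (a₀ D : ℚ) (P P' : MvPolynomial (Fin 2) ℚ) :
    normAlt a₀ D (P - P') = normAlt a₀ D P - normAlt a₀ D P' := by
  rw [sub_eq_add_neg, normAlt_add, normAlt_neg, ← sub_eq_add_neg]

/-- Monomial values. [folklore] -/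
theorem normAlt_XX_pow (a₀ D : ℚ) (i j : ℕ) : normAlt a₀ D (X 0 ^ i * X 1 ^ j) = lam a₀ D i j := by
  have : (X 0 ^ i * X 1 ^ j : MvPolynomial (Fin 2) ℚ) = monomial (Finsupp.single 0 i + Finsupp.single 1 j) 1 := by
    rw [X_pow_eq_monomial, X_pow_eq_monomial, monomial_mul, one_mul]
  rw [this, normAlt_monomial]
  simp [normFn]

/-- Auxiliary step `normAlt_X0_pow` (§13): norm Alt X0 pow. [bookkeeping] -/
theorem normAlt_X0_pow (a₀ D : ℚ) (i : ℕ) : normAlt a₀ D (X 0 ^ i) = upow a₀ i := by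
  rw [← lam_zero a₀ D, ← normAlt_XX_pow a₀ D i 0, pow_zero, mul_one]

/-- Auxiliary step `normAlt_X1_pow` (§13): norm Alt X1 pow. [bookkeeping] -/
theorem normAlt_X1_pow (a₀ D : ℚ) (j : ℕ) : normAlt a₀ D (X 1 ^ j) = lam a₀ D 0 j := by
  rw [← normAlt_XX_pow a₀ D 0 j, pow_zero, one_mul]

/-- Auxiliary step `normAlt_X` (§13): norm Alt X. [bookkeeping] -/
theorem normAlt_X (a₀ D : ℚ) (k : Fin 2) : normAlt a₀ D (X k) = 0 := by
  fin_cases k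
  · show normAlt a₀ D (X 0) = 0
    rw [← pow_one (X 0 : MvPolynomial (Fin 2) ℚ), normAlt_X0_pow, upow_one]
  · show normAlt a₀ D (X 1) = 0
    rw [← pow_one (X 1 : MvPolynomial (Fin 2) ℚ), normAlt_X1_pow, lam_one]

/-- **Every numerator is congruent to its functional modulo exact ones**: `P − normAlt(P)·1 ∈ Ex0 (a₀ + u² − Dv²)` (`D ≠ 0`). [folklore] -/
theorem sub_C_normAlt_mem (a₀ D : ℚ) (hD : D ≠ 0) (P : MvPolynomial (Fin 2) ℚ) :
    P - C (normAlt a₀ D P) ∈ Ex0 (normQ a₀ D) := by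
  induction P using MvPolynomial.induction_on' with
  | monomial d a =>
    rw [normAlt_monomial]
    have hmon : (monomial d a : MvPolynomial (Fin 2) ℚ) = a • (X 0 ^ (d 0) * X 1 ^ (d 1)) := by
      rw [monomial_eq, Finsupp.prod_pow, Fin.prod_univ_two, smul_eq_C_mul]
    have key : (a • (X 0 ^ (d 0) * X 1 ^ (d 1)) - C (a * lam a₀ D (d 0) (d 1)) : MvPolynomial (Fin 2) ℚ)
        = a • (X 0 ^ (d 0) * X 1 ^ (d 1) - C (lam a₀ D (d 0) (d 1))) := by
      rw [smul_eq_C_mul, smul_eq_C_mul, map_mul]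
      ring
    unfold normFn
    rw [hmon, key]
    exact Submodule.smul_mem _ _ (normMonomial_sub_C_mem a₀ D hD (d 1) (d 0))
  | add p q hp hq =>
    have : p + q - C (normAlt a₀ D (p + q)) = (p - C (normAlt a₀ D p)) + (q - C (normAlt a₀ D q)) := by
      rw [normAlt_add, map_add]; ring
    rw [this]
    exact add_mem hp hq

end Summit.KontsevichZagierPeriods.RootDecompRationalCubeDichotomy.Rung26322.RankDescent
end
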